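import Mathlib
import Literature.AlgebraicGeometry.Resolution.CobordantGame
import Literature.AlgebraicGeometry.Resolution.CobordantChartCoefficients
import Literature.AlgebraicGeometry.Resolution.AxisPolyhedron
import Summits.ResolutionOfSingularities.ResolutionOfSingularities.Theorems.WeightedInvariantLocalWeightedDropAxisMove

/-!
# `WeightedInvariant.LocalWeightedDrop`, line `hasse-ridge-face-selection`: the weighted move (B2), part 1 —
# exponent bookkeeping, the weights `(m, …, m, 1)`, and the Taylor identification

Crux item stmt-ResolutionOfSingularities-8899 (route `ResolutionOfSingularities/WeightedInvariant`), skeleton v18 of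
the line `hasse-ridge-face-selection`, helpers toward stub `stub_axisWeightedMove` (B2: the weighted move
`(m, …, m, 1)` from a prepared axis germ).  Coordinates: `g ∈ k[[x'₁, …, x'ₙ, z]]`, `z = Fin.last n`,
`x'_j = Fin.castSucc j`; an exponent is written `(b, e)` with `b : Fin n →₀ ℕ` its `x'`-part and `e` its
`z`-exponent (`Finsupp.equivFunOnFinite.symm (Fin.snoc ⇑b e)`).

Contents (char-free coefficient algebra; `k` infinite only for the Taylor identification): `finsum_eq_sum_snoc`
(re-indexing finitely supported sums over exponents by `x'`-parts); `weight_eq`, `weightedOrder_eq`, `isMove` (for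
`w = (m, …, m, 1)`: `w · E = m |b| + e`, the `w`-order of an axis germ of order `d` above the level `m` is `m d`,
`(X, w)` is a legal move); `initEval_snoc_zero` (under `AxisCone` the degree-`d` form is `F(v) = Σ_{|b| = d} g_{(b,0)} v^b`);
`taylorCoeff_eq_sum`, `taylorCoeff_smul` (Hasse–Taylor coefficient as a finite sum, homogeneity
`taylorCoeff (t • λ) (a, ·) = t^{d - |a|} taylorCoeff λ (a, ·)`); `mul_pow_eq_taylorCoeff_of_eval`, `solvable_of_eval` —
THE TAYLOR IDENTIFICATION: if `F(v - γ) = F(v) + Σ_{|a| < d} g_{(a, M(d-|a|))} t^{M(d-|a|)} v^a` on `kⁿ`, then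
`g_{(a, M(d-|a|))} t^{M(d-|a|)}` is the Taylor coefficient of `F(X' - γ)` at `X'^a`, so for `t ≠ 0` the vector `-γ / t^M`
SOLVES the level-`M` vertex (`AxisPolyhedron.Solvable`) when `δ ≥ M` (`MvPolynomial.funext`, `k` infinite).
-/

set_option linter.dupNamespace false -- mandated namespace of this single-conjunct summit

namespace Summit.ResolutionOfSingularities.ResolutionOfSingularities.Theorems

open Literature.AlgebraicGeometry.Resolution

namespace AxisWeightedMove

variable {k : Type} [Field k] {n : ℕ}

/-! ### Exponents `(b, e)`: `x'`-part `b`, `z`-exponent `e` -/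

/-- The `x'`-components of the exponent `(b, e)`. -/
@[simp] theorem snoc_castSucc (b : Fin n →₀ ℕ) (e : ℕ) (j : Fin n) :
    (Finsupp.equivFunOnFinite.symm (Fin.snoc (⇑b) e : Fin (n + 1) → ℕ)) (Fin.castSucc j) = b j := by
  rw [Finsupp.coe_equivFunOnFinite_symm, Fin.snoc_castSucc]

/-- The `z`-component of the exponent `(b, e)`. -/
@[simp] theorem snoc_last (b : Fin n →₀ ℕ) (e : ℕ) :
    (Finsupp.equivFunOnFinite.symm (Fin.snoc (⇑b) e : Fin (n + 1) → ℕ)) (Fin.last n) = e := by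
  rw [Finsupp.coe_equivFunOnFinite_symm, Fin.snoc_last]

/-- The `x'`-degree of `(b, e)` is `|b|`. -/
theorem xDeg_snoc (b : Fin n →₀ ℕ) (e : ℕ) :
    AxisPolyhedron.xDeg (Finsupp.equivFunOnFinite.symm (Fin.snoc (⇑b) e : Fin (n + 1) → ℕ)) = b.degree := by
  rw [AxisPolyhedron.xDeg, Finsupp.degree_eq_sum]
  exact Finset.sum_congr rfl fun j _ => snoc_castSucc b e j

/-- The total degree of `(b, e)` is `|b| + e`. -/
theorem degree_snoc (b : Fin n →₀ ℕ) (e : ℕ) :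
    (Finsupp.equivFunOnFinite.symm (Fin.snoc (⇑b) e : Fin (n + 1) → ℕ)).degree = b.degree + e := by
  rw [AxisMove.degree_eq_xDeg_add, xDeg_snoc, snoc_last]

/-- The `x'`-part of `(b, e)` is `b`. -/
@[simp] theorem xPart_snoc (b : Fin n →₀ ℕ) (e : ℕ) :
    (Finsupp.equivFunOnFinite.symm fun j : Fin n =>
      (Finsupp.equivFunOnFinite.symm (Fin.snoc (⇑b) e : Fin (n + 1) → ℕ)) (Fin.castSucc j)) = b := by
  ext j
  rw [Finsupp.coe_equivFunOnFinite_symm, snoc_castSucc]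

/-- An exponent is `(its x'-part, its z-exponent)`. -/
theorem snoc_xPart (E : Fin (n + 1) →₀ ℕ) :
    Finsupp.equivFunOnFinite.symm (Fin.snoc (⇑(Finsupp.equivFunOnFinite.symm fun j : Fin n =>
      E (Fin.castSucc j))) (E (Fin.last n)) : Fin (n + 1) → ℕ) = E := by
  ext i
  refine Fin.lastCases ?_ (fun j => ?_) i
  · rw [snoc_last]
  · rw [snoc_castSucc, Finsupp.coe_equivFunOnFinite_symm]

/-- The `x'`-degree of `E` is the degree of its `x'`-part. -/
theorem xDeg_eq_degree_xPart (E : Fin (n + 1) →₀ ℕ) :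
    AxisPolyhedron.xDeg E = (Finsupp.equivFunOnFinite.symm fun j : Fin n => E (Fin.castSucc j)).degree := by
  rw [AxisPolyhedron.xDeg, Finsupp.degree_eq_sum]
  rfl

/-- Membership in `univ.finsuppAntidiag d` is having degree `d`. -/
theorem mem_antidiag_iff_degree (d : ℕ) (b : Fin n →₀ ℕ) :
    b ∈ (Finset.univ : Finset (Fin n)).finsuppAntidiag d ↔ b.degree = d := by
  rw [ApexFreeOrderDrop.mem_antidiag_iff, ApexFreeOrderDrop.weight_one_eq_degree]

/-- Membership in the set of exponents of degree `< d`. -/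
theorem mem_below_iff (d : ℕ) (b : Fin n →₀ ℕ) :
    b ∈ (Finset.range d).biUnion (fun r => (Finset.univ : Finset (Fin n)).finsuppAntidiag r) ↔
      b.degree < d := by
  simp only [Finset.mem_biUnion, Finset.mem_range, mem_antidiag_iff_degree]
  exact ⟨fun ⟨r, hr, hbr⟩ => hbr ▸ hr, fun h => ⟨_, h, rfl⟩⟩

/-- RE-INDEXING BY `x'`-PARTS: a finitely supported sum over exponents `E` whose support lies over a finite
set `S` of `x'`-parts, with the `z`-exponent a function `ψ` of the `x'`-part, is the finite sum over `b ∈ S`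
of the terms at `(b, ψ b)`. -/
theorem finsum_eq_sum_snoc {M : Type*} [AddCommMonoid M] (S : Finset (Fin n →₀ ℕ))
    (ψ : (Fin n →₀ ℕ) → ℕ) (T : (Fin (n + 1) →₀ ℕ) → M)
    (hT : ∀ E, T E ≠ 0 → (Finsupp.equivFunOnFinite.symm fun j : Fin n => E (Fin.castSucc j)) ∈ S ∧
      E (Fin.last n) = ψ (Finsupp.equivFunOnFinite.symm fun j : Fin n => E (Fin.castSucc j))) :
    ∑ᶠ E, T E = ∑ b ∈ S, T (Finsupp.equivFunOnFinite.symm (Fin.snoc (⇑b) (ψ b) : Fin (n + 1) → ℕ)) := by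
  classical
  rw [finsum_eq_sum_of_support_subset T
    (s := S.image fun b : Fin n →₀ ℕ =>
      Finsupp.equivFunOnFinite.symm (Fin.snoc (⇑b) (ψ b) : Fin (n + 1) → ℕ)) ?_]
  · rw [Finset.sum_image]
    intro b₁ _ b₂ _ h
    have h' := congrArg (fun E : Fin (n + 1) →₀ ℕ =>
      (Finsupp.equivFunOnFinite.symm fun j : Fin n => E (Fin.castSucc j))) h
    simpa only [xPart_snoc] using h'
  · intro E hE
    obtain ⟨hS, hlast⟩ := hT E hE
    rw [Finset.coe_image]
    refine ⟨_, Finset.mem_coe.mpr hS, ?_⟩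
    show Finsupp.equivFunOnFinite.symm (Fin.snoc _ (ψ _)) = E
    rw [← hlast]
    exact snoc_xPart E

/-! ### The weights `(m, …, m, 1)` -/

/-- For the weights `(m, …, m, 1)` the weight of an exponent is `m |b| + e`. -/
theorem weight_eq {w : Fin (n + 1) → ℕ} {m : ℕ} (hw1 : w (Fin.last n) = 1)
    (hwm : ∀ j, w (Fin.castSucc j) = m) (E : Fin (n + 1) →₀ ℕ) :
    Finsupp.weight w E = m * AxisPolyhedron.xDeg E + E (Fin.last n) := by
  rw [Finsupp.weight_apply, Finsupp.sum_fintype _ _ (fun i => by simp), Fin.sum_univ_castSucc, hw1]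
  simp only [hwm, smul_eq_mul, mul_one]
  rw [AxisPolyhedron.xDeg, Finset.mul_sum]
  exact congrArg (· + E (Fin.last n)) (Finset.sum_congr rfl fun j _ => mul_comm _ _)

/-- All the weights `(m, …, m, 1)` are positive when `m ≥ 1`, so the crux's chart convention is vacuous
and the crux's point `(c_i if w_i > 0 else 0)` is `c`. -/
theorem weight_pos {w : Fin (n + 1) → ℕ} {m : ℕ} (hw1 : w (Fin.last n) = 1)
    (hwm : ∀ j, w (Fin.castSucc j) = m) (hm : 1 ≤ m) (i : Fin (n + 1)) : 0 < w i := by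
  rcases Fin.eq_castSucc_or_eq_last i with ⟨j, rfl⟩ | rfl
  · rw [hwm]; exact hm
  · rw [hw1]; exact one_pos

/-- Above the level `m` (`AboveLevel d m 1 g`: every monomial `x'^a z^c` with `|a| < d` has `c ≥ m (d - |a|)`)
every monomial of `g` has `w`-weight `≥ m d`. -/
theorem le_weight_of_coeff_ne_zero {w : Fin (n + 1) → ℕ} {m : ℕ} (hw1 : w (Fin.last n) = 1)
    (hwm : ∀ j, w (Fin.castSucc j) = m) {d : ℕ} {g : MvPowerSeries (Fin (n + 1)) k}
    (hlev : AxisPolyhedron.AboveLevel d m 1 g) {E : Fin (n + 1) →₀ ℕ} (hE : MvPowerSeries.coeff E g ≠ 0) :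
    m * d ≤ Finsupp.weight w E := by
  rw [weight_eq hw1 hwm]
  by_cases hx : AxisPolyhedron.xDeg E < d
  · have hz : m * (d - AxisPolyhedron.xDeg E) ≤ E (Fin.last n) := by
      by_contra hlt
      push Not at hlt
      exact hE (hlev E hx (by rw [one_mul]; exact hlt))
    calc m * d = m * AxisPolyhedron.xDeg E + m * (d - AxisPolyhedron.xDeg E) := by
          rw [← Nat.mul_add, Nat.add_sub_cancel' hx.le]
      _ ≤ _ := Nat.add_le_add_left hz _
  · push Not at hx
    exact le_trans (Nat.mul_le_mul_left m hx) (Nat.le_add_right _ _)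

/-- THE `w`-ORDER OF A PREPARED AXIS GERM: for `g` of order `d` with `AxisCone` (so a monomial `x'^b`, `|b| = d`,
occurs) above the level `m`, the `(m, …, m, 1)`-order of `g` is `m d`. -/
theorem weightedOrder_eq {w : Fin (n + 1) → ℕ} {m : ℕ} (hw1 : w (Fin.last n) = 1)
    (hwm : ∀ j, w (Fin.castSucc j) = m) {d : ℕ} {g : MvPowerSeries (Fin (n + 1)) k}
    (hlev : AxisPolyhedron.AboveLevel d m 1 g) (hcone : AxisPolyhedron.AxisCone d g) (hgd : g.order = d)
    (hg : g ≠ 0) : g.weightedOrder w = (m * d : ℕ) := by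
  apply le_antisymm
  · obtain ⟨E, hE, hEd⟩ := MvPowerSeries.exists_coeff_ne_zero_and_order
      ((MvPowerSeries.ne_zero_iff_order_finite).mp hg)
    rw [hgd, Nat.cast_inj] at hEd
    have hEz : E (Fin.last n) = 0 := by
      by_contra h
      exact hE (hcone E hEd h)
    refine (MvPowerSeries.weightedOrder_le w hE).trans ?_
    rw [weight_eq hw1 hwm, hEz, add_zero, Nat.cast_le]
    rw [AxisMove.degree_eq_xDeg_add, hEz, add_zero] at hEd
    rw [hEd]
  · exact MvPowerSeries.nat_le_weightedOrder w fun E hE => by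
      by_contra hne
      exact absurd (le_weight_of_coeff_ne_zero hw1 hwm hlev hne) (not_le.mpr hE)

/-- THE MOVE `(X, (m, …, m, 1))` IS LEGAL. -/
theorem isMove (w : Fin (n + 1) → ℕ) (hw1 : w (Fin.last n) = 1) :
    CobordantGame.IsMove k (MvPowerSeries.X : Fin (n + 1) → MvPowerSeries (Fin (n + 1)) k) w :=
  ⟨fun i => MvPowerSeries.constantCoeff_X i, (TangentConeCut.isMove_X_one (Nat.succ_pos n)).2.1,
    ⟨Fin.last n, by rw [hw1]; exact one_pos⟩⟩

/-! ### The degree-`d` form of an axis germ in the `x'`-coordinates -/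

/-- Under `AxisCone d g` the degree-`d` form of `g` at a point `(v, 0)` is `F(v) = Σ_{|b| = d} g_{(b, 0)} v^b`. -/
theorem initEval_snoc_zero {d : ℕ} {g : MvPowerSeries (Fin (n + 1)) k} (hcone : AxisPolyhedron.AxisCone d g)
    (v : Fin n → k) :
    CobordantChart.initEval (fun _ : Fin (n + 1) => 1) (Fin.snoc v 0 : Fin (n + 1) → k) d g =
      ∑ b ∈ (Finset.univ : Finset (Fin n)).finsuppAntidiag d,
        MvPowerSeries.coeff (Finsupp.equivFunOnFinite.symm (Fin.snoc (⇑b) 0 : Fin (n + 1) → ℕ)) g *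
          ∏ j, v j ^ b j := by
  rw [CobordantChart.initEval, finsum_eq_sum_snoc ((Finset.univ : Finset (Fin n)).finsuppAntidiag d)
    (fun _ => 0) _ ?_]
  · refine Finset.sum_congr rfl fun b hb => ?_
    rw [if_pos (by rw [ApexFreeOrderDrop.weight_one_eq_degree, degree_snoc, add_zero,
      (mem_antidiag_iff_degree d b).mp hb]), Fin.prod_univ_castSucc]
    simp only [snoc_castSucc, snoc_last, Fin.snoc_castSucc, pow_zero, mul_one]
  · intro E hE
    have hw : Finsupp.weight (fun _ : Fin (n + 1) => 1) E = d := by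
      by_contra h
      exact hE (if_neg h)
    rw [if_pos hw] at hE
    rw [ApexFreeOrderDrop.weight_one_eq_degree] at hw
    have hEz : E (Fin.last n) = 0 := by
      by_contra hz
      rcases mul_ne_zero_iff.mp hE with ⟨hg, hprod⟩
      exact hg (hcone E hw hz)
    refine ⟨(mem_antidiag_iff_degree d _).mpr ?_, hEz⟩
    rw [← xDeg_eq_degree_xPart]
    rw [AxisMove.degree_eq_xDeg_add, hEz, add_zero] at hw
    exact hw

/-- `(v, 0) + (u, 0) = (v + u, 0)`. -/
theorem snoc_add_snoc (v u : Fin n → k) :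
    (Fin.snoc v 0 : Fin (n + 1) → k) + Fin.snoc u 0 = Fin.snoc (v + u) 0 := by
  funext i
  refine Fin.lastCases ?_ (fun j => ?_) i
  · simp
  · simp

/-! ### Hironaka's Hasse–Taylor coefficient -/

/-- The Hasse–Taylor coefficient as a finite sum over the exponents `b` with `|b| = d`:
`taylorCoeff d g λ (a, ·) = Σ_{|b| = d} g_{(b, 0)} Π_j C(b_j, a_j) λ_j^{b_j - a_j}` (the constraint `a ≤ b` of the
definition is automatic: `C(b_j, a_j) = 0` otherwise). -/
theorem taylorCoeff_eq_sum (d : ℕ) (g : MvPowerSeries (Fin (n + 1)) k) (lam : Fin n → k)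
    (E : Fin (n + 1) →₀ ℕ) :
    AxisPolyhedron.taylorCoeff d g lam E =
      ∑ b ∈ (Finset.univ : Finset (Fin n)).finsuppAntidiag d,
        MvPowerSeries.coeff (Finsupp.equivFunOnFinite.symm (Fin.snoc (⇑b) 0 : Fin (n + 1) → ℕ)) g *
          ∏ j, (((b j).choose (E (Fin.castSucc j)) : k) * lam j ^ (b j - E (Fin.castSucc j))) := by
  classical
  rw [AxisPolyhedron.taylorCoeff, finsum_eq_sum_snoc ((Finset.univ : Finset (Fin n)).finsuppAntidiag d)
    (fun _ => 0) _ ?_]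
  · refine Finset.sum_congr rfl fun b hb => ?_
    by_cases hle : ∀ j : Fin n, E (Fin.castSucc j) ≤ b j
    · rw [if_pos ⟨by rw [degree_snoc, add_zero, (mem_antidiag_iff_degree d b).mp hb], snoc_last b 0,
        fun j => by rw [snoc_castSucc]; exact hle j⟩]
      simp only [snoc_castSucc]
    · push Not at hle
      obtain ⟨j, hj⟩ := hle
      simp only [snoc_castSucc]
      rw [Finset.prod_eq_zero (Finset.mem_univ j) (by rw [Nat.choose_eq_zero_of_lt hj, Nat.cast_zero,
        zero_mul]), mul_zero]
      split_ifs <;> rfl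
  · intro B hB
    have hcond : B.degree = d ∧ B (Fin.last n) = 0 ∧ ∀ j : Fin n, E (Fin.castSucc j) ≤ B (Fin.castSucc j) := by
      by_contra h
      exact hB (if_neg h)
    refine ⟨(mem_antidiag_iff_degree d _).mpr ?_, hcond.2.1⟩
    rw [← xDeg_eq_degree_xPart]
    have h := hcond.1
    rw [AxisMove.degree_eq_xDeg_add, hcond.2.1, add_zero] at h
    exact h

/-- HOMOGENEITY of the Hasse–Taylor coefficient in the vector: `taylorCoeff (t • λ) (a, ·) = t^{d - |a|} taylorCoeff λ (a, ·)`
for `|a| ≤ d`. -/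
theorem taylorCoeff_smul (d : ℕ) (g : MvPowerSeries (Fin (n + 1)) k) (t : k) (lam : Fin n → k)
    (E : Fin (n + 1) →₀ ℕ) (hx : AxisPolyhedron.xDeg E ≤ d) :
    AxisPolyhedron.taylorCoeff d g (t • lam) E = t ^ (d - AxisPolyhedron.xDeg E) * AxisPolyhedron.taylorCoeff d g lam E := by
  rw [taylorCoeff_eq_sum, taylorCoeff_eq_sum, Finset.mul_sum]
  refine Finset.sum_congr rfl fun b hb => ?_
  by_cases hle : ∀ j : Fin n, E (Fin.castSucc j) ≤ b j
  · have hsum : ∑ j, (b j - E (Fin.castSucc j)) = d - AxisPolyhedron.xDeg E := by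
      have h : ∑ j, (b j - E (Fin.castSucc j)) + AxisPolyhedron.xDeg E = d := by
        rw [AxisPolyhedron.xDeg, ← Finset.sum_add_distrib, ← (mem_antidiag_iff_degree d b).mp hb,
          Finsupp.degree_eq_sum]
        exact Finset.sum_congr rfl fun j _ => Nat.sub_add_cancel (hle j)
      omega
    have hprod : ∏ j, (((b j).choose (E (Fin.castSucc j)) : k) * (t • lam) j ^ (b j - E (Fin.castSucc j))) =
        t ^ (d - AxisPolyhedron.xDeg E) *
          ∏ j, (((b j).choose (E (Fin.castSucc j)) : k) * lam j ^ (b j - E (Fin.castSucc j))) := by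
      simp only [Pi.smul_apply, smul_eq_mul, mul_pow]
      rw [← hsum, ← Finset.prod_pow_eq_pow_sum, ← Finset.prod_mul_distrib]
      exact Finset.prod_congr rfl fun j _ => by ring
    rw [hprod]
    ring
  · push Not at hle
    obtain ⟨j, hj⟩ := hle
    have h0 : ∀ (μ : Fin n → k), ∏ j, (((b j).choose (E (Fin.castSucc j)) : k) * μ j ^ (b j - E (Fin.castSucc j))) = 0 :=
      fun μ => Finset.prod_eq_zero (Finset.mem_univ j) (by rw [Nat.choose_eq_zero_of_lt hj, Nat.cast_zero, zero_mul])
    simp only [h0, mul_zero]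

/-! ### The Taylor identification -/

/-- Coefficients of the translated form `Σ_{|b| = d} g_{(b,0)} Π_j (X_j - γ_j)^{b_j}` are the Hasse–Taylor
coefficients at `-γ`. -/
theorem coeff_translateForm (d : ℕ) (g : MvPowerSeries (Fin (n + 1)) k) (γ : Fin n → k) (a : Fin n →₀ ℕ)
    (E : Fin (n + 1) →₀ ℕ) (hE : ∀ j, E (Fin.castSucc j) = a j) :
    MvPolynomial.coeff a (∑ b ∈ (Finset.univ : Finset (Fin n)).finsuppAntidiag d,
        MvPolynomial.C (MvPowerSeries.coeff (Finsupp.equivFunOnFinite.symm (Fin.snoc (⇑b) 0 : Fin (n + 1) → ℕ)) g) *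
          ∏ j, (MvPolynomial.C (-γ j) + MvPolynomial.X j) ^ (b j)) =
      AxisPolyhedron.taylorCoeff d g (-γ) E := by
  rw [taylorCoeff_eq_sum, MvPolynomial.coeff_sum]
  refine Finset.sum_congr rfl fun b _ => ?_
  rw [MvPolynomial.coeff_C_mul, CobordantChart.coeff_prod_C_add_X_pow]
  simp only [hE, Pi.neg_apply]

/-- THE TAYLOR IDENTIFICATION (infinite `k`).  If for every `v ∈ kⁿ`
`Σ_{|b| = d} g_{(b,0)} (v - γ)^b = Σ_{|b| = d} g_{(b,0)} v^b + Σ_{|b| < d} g_{(b, M(d-|b|))} t^{M(d-|b|)} v^b`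
(i.e. `F(v - γ) = F(v) + Λ_M(v, t)` with `Λ_M` the level-`M` part of `g`), then for every exponent `E = (a, M(d-|a|))`
with `|a| < d`: `g_E · t^{M(d-|a|)} = taylorCoeff d g (-γ) E`. -/
theorem mul_pow_eq_taylorCoeff_of_eval [Infinite k] {d M : ℕ} {g : MvPowerSeries (Fin (n + 1)) k} {t : k}
    {γ : Fin n → k}
    (h : ∀ v : Fin n → k,
      ∑ b ∈ (Finset.univ : Finset (Fin n)).finsuppAntidiag d,
          MvPowerSeries.coeff (Finsupp.equivFunOnFinite.symm (Fin.snoc (⇑b) 0 : Fin (n + 1) → ℕ)) g *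
            ∏ j, (v j - γ j) ^ b j =
        ∑ b ∈ (Finset.univ : Finset (Fin n)).finsuppAntidiag d,
          MvPowerSeries.coeff (Finsupp.equivFunOnFinite.symm (Fin.snoc (⇑b) 0 : Fin (n + 1) → ℕ)) g *
            ∏ j, v j ^ b j +
        ∑ b ∈ (Finset.range d).biUnion (fun r => (Finset.univ : Finset (Fin n)).finsuppAntidiag r),
          MvPowerSeries.coeff (Finsupp.equivFunOnFinite.symm
              (Fin.snoc (⇑b) (M * (d - b.degree)) : Fin (n + 1) → ℕ)) g * t ^ (M * (d - b.degree)) *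
            ∏ j, v j ^ b j)
    (E : Fin (n + 1) →₀ ℕ) (hx : AxisPolyhedron.xDeg E < d) (hEz : E (Fin.last n) = M * (d - AxisPolyhedron.xDeg E)) :
    MvPowerSeries.coeff E g * t ^ (M * (d - AxisPolyhedron.xDeg E)) = AxisPolyhedron.taylorCoeff d g (-γ) E := by
  classical
  -- the two sides as polynomials in `X'`
  set L : MvPolynomial (Fin n) k := ∑ b ∈ (Finset.univ : Finset (Fin n)).finsuppAntidiag d,
    MvPolynomial.C (MvPowerSeries.coeff (Finsupp.equivFunOnFinite.symm (Fin.snoc (⇑b) 0 : Fin (n + 1) → ℕ)) g) *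
      ∏ j, (MvPolynomial.C (-γ j) + MvPolynomial.X j) ^ (b j) with hL
  set R : MvPolynomial (Fin n) k := ∑ b ∈ (Finset.univ : Finset (Fin n)).finsuppAntidiag d,
      MvPolynomial.monomial b (MvPowerSeries.coeff (Finsupp.equivFunOnFinite.symm (Fin.snoc (⇑b) 0 : Fin (n + 1) → ℕ)) g) +
    ∑ b ∈ (Finset.range d).biUnion (fun r => (Finset.univ : Finset (Fin n)).finsuppAntidiag r),
      MvPolynomial.monomial b (MvPowerSeries.coeff (Finsupp.equivFunOnFinite.symm
        (Fin.snoc (⇑b) (M * (d - b.degree)) : Fin (n + 1) → ℕ)) g * t ^ (M * (d - b.degree))) with hR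
  have hLR : L = R := by
    refine MvPolynomial.funext fun v => ?_
    have hl : MvPolynomial.eval v L = ∑ b ∈ (Finset.univ : Finset (Fin n)).finsuppAntidiag d,
        MvPowerSeries.coeff (Finsupp.equivFunOnFinite.symm (Fin.snoc (⇑b) 0 : Fin (n + 1) → ℕ)) g *
          ∏ j, (v j - γ j) ^ b j := by
      rw [hL, map_sum]
      refine Finset.sum_congr rfl fun b _ => ?_
      rw [map_mul, MvPolynomial.eval_C, map_prod]
      congr 1
      refine Finset.prod_congr rfl fun j _ => ?_
      rw [map_pow, map_add, MvPolynomial.eval_C, MvPolynomial.eval_X, neg_add_eq_sub]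
    have hr : MvPolynomial.eval v R = ∑ b ∈ (Finset.univ : Finset (Fin n)).finsuppAntidiag d,
          MvPowerSeries.coeff (Finsupp.equivFunOnFinite.symm (Fin.snoc (⇑b) 0 : Fin (n + 1) → ℕ)) g *
            ∏ j, v j ^ b j +
        ∑ b ∈ (Finset.range d).biUnion (fun r => (Finset.univ : Finset (Fin n)).finsuppAntidiag r),
          MvPowerSeries.coeff (Finsupp.equivFunOnFinite.symm
              (Fin.snoc (⇑b) (M * (d - b.degree)) : Fin (n + 1) → ℕ)) g * t ^ (M * (d - b.degree)) *
            ∏ j, v j ^ b j := by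
      rw [hR, map_add, map_sum, map_sum]
      congr 1
      · refine Finset.sum_congr rfl fun b _ => ?_
        rw [MvPolynomial.eval_monomial, Finsupp.prod_pow]
      · refine Finset.sum_congr rfl fun b _ => ?_
        rw [MvPolynomial.eval_monomial, Finsupp.prod_pow]
    rw [hl, hr]
    exact h v
  -- compare the coefficients at `a = x'-part of E`
  set a : Fin n →₀ ℕ := Finsupp.equivFunOnFinite.symm fun j : Fin n => E (Fin.castSucc j) with ha
  have hEa : ∀ j, E (Fin.castSucc j) = a j := fun j => by rw [ha, Finsupp.coe_equivFunOnFinite_symm]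
  have hadeg : a.degree = AxisPolyhedron.xDeg E := (xDeg_eq_degree_xPart E).symm
  have hEsnoc : Finsupp.equivFunOnFinite.symm (Fin.snoc (⇑a) (M * (d - a.degree)) : Fin (n + 1) → ℕ) = E := by
    rw [hadeg, ← hEz, ha]
    exact snoc_xPart E
  have hcoef := congrArg (MvPolynomial.coeff a) hLR
  rw [hL, coeff_translateForm d g γ a E hEa, hR, MvPolynomial.coeff_add, MvPolynomial.coeff_sum,
    MvPolynomial.coeff_sum, Finset.sum_eq_zero (fun b hb => ?_), zero_add,
    Finset.sum_eq_single a (fun b _ hba => by rw [MvPolynomial.coeff_monomial, if_neg hba])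
      (fun hna => absurd ((mem_below_iff d a).mpr (hadeg ▸ hx)) hna),
    MvPolynomial.coeff_monomial, if_pos rfl, hEsnoc, hadeg] at hcoef
  · exact hcoef.symm
  · rw [MvPolynomial.coeff_monomial, if_neg]
    rintro rfl
    rw [mem_antidiag_iff_degree] at hb
    omega

/-- THE SOLVING VECTOR.  Under the hypothesis of `mul_pow_eq_taylorCoeff_of_eval` with `t ≠ 0`, and above the level
`M` (`δ ≥ M`), the vector `λ = -γ / t^M` solves the level-`M` vertex of `g`: `AxisPolyhedron.Solvable d M λ g`
(homogeneity of the Taylor coefficient). -/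
theorem solvable_of_eval [Infinite k] {d M : ℕ} {g : MvPowerSeries (Fin (n + 1)) k} {t : k} (ht : t ≠ 0)
    {γ : Fin n → k} (hlev : AxisPolyhedron.AboveLevel d M 1 g)
    (h : ∀ v : Fin n → k,
      ∑ b ∈ (Finset.univ : Finset (Fin n)).finsuppAntidiag d,
          MvPowerSeries.coeff (Finsupp.equivFunOnFinite.symm (Fin.snoc (⇑b) 0 : Fin (n + 1) → ℕ)) g *
            ∏ j, (v j - γ j) ^ b j =
        ∑ b ∈ (Finset.univ : Finset (Fin n)).finsuppAntidiag d,
          MvPowerSeries.coeff (Finsupp.equivFunOnFinite.symm (Fin.snoc (⇑b) 0 : Fin (n + 1) → ℕ)) g *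
            ∏ j, v j ^ b j +
        ∑ b ∈ (Finset.range d).biUnion (fun r => (Finset.univ : Finset (Fin n)).finsuppAntidiag r),
          MvPowerSeries.coeff (Finsupp.equivFunOnFinite.symm
              (Fin.snoc (⇑b) (M * (d - b.degree)) : Fin (n + 1) → ℕ)) g * t ^ (M * (d - b.degree)) *
            ∏ j, v j ^ b j) :
    AxisPolyhedron.Solvable d M ((t ^ M)⁻¹ • (-γ)) g := by
  refine ⟨hlev, fun E hx hEz => ?_⟩
  have h1 := mul_pow_eq_taylorCoeff_of_eval h E hx hEz
  rw [taylorCoeff_smul d g _ _ E hx.le, ← h1, inv_pow, ← pow_mul, mul_comm, mul_assoc,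
    mul_inv_cancel₀ (pow_ne_zero _ ht), mul_one]

end AxisWeightedMove

end Summit.ResolutionOfSingularities.ResolutionOfSingularities.Theorems
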